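import Summits.QuantumFields.YangMills.Theorems.BalabanUVNodesN11NoExpansionTermFreeAnyWeights
import Summits.QuantumFields.YangMills.Theorems.BalabanUVNodesN21AveragedDatumRegularity

/-!
# DAG node N11 — ON ROUGH COARSE FIELDS THE ALL-LARGE-FIELD PRE-𝐑 SLOT MUST VANISH: at EVERY Stage-13 witness (any residual 𝐓-weights `θ.Zt`), for every
# term-value witness, `TLaw₁₃ θ p 0` forces def-T's level-1 pre-𝐑 slot of the all-large-field new sequence, `slotT_1(s′₀)(V₁) = ∫dU δ(ŪV₁⁻¹) w(s′₀)(U,V₁)ρ₀(U)`,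
# to VANISH for `dV₁`-almost every `V₁` that is NOT `2α₀`-plaquette-small — the kernel half of the located question Q-W

Cell `pub-ymgap`, YM-PLAN Track A (HUMAN RULING D-0062), seat `pub-ymgap-dag-n11-d` (g4; R134 fan-out seat N11 [B14], strategy s2), item K1‴ `StabilityBAtRecordR13e`
= stmt-QuantumFields-19910.  [III] = [Balaban1988Convergent], [B7] = [Balaban1985Averaging].  Sequel of this seat's `BalabanUVNodesN11NoExpansionTermFree` (p495297)
and `…TermFreeAnyWeights` (p496263: the term-free no-expansion integrand at ANY `θ.Zt` is supported on the `cR·ε₀`-regular fine fields), over seat dag-n21-c's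
PROVED Proposition 2 of [B7] at the averaging of record (`N21AveragedDatumRegularity.plaqSmall_iter_avOfRecord_level`: a plaquette-small fine field has a
plaquette-small block average) and g3's fibre lemma (`TkNoExpansionStepZero.transportK_congr_ae_of_fibre`).

WHY THIS FILE.  `…TermFreeAnyWeights.tLaw₁₃_zero_termFree` says: at any witness, N11's first (S1ᵀ)₁₃ instance at the all-large-field sequence `s′₀` is EITHER
`slotT_1(s′₀) ≡ 0` OR the a.e. equality of `T[w(s′₀)ρ₀]` with the transport of an integrand that VANISHES at every `cR·ε₀`-irregular fine field `U`.  By [B7]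
Prop. 2 (n21-c), a `cR·ε₀`-regular `U` has a `2α₀`-plaquette-small average whenever `cR·ε₀ ≤ α₀η₁²` (guards on `α₀` displayed); so over a coarse field `V₁` that is
NOT `2α₀`-small, EVERY fine field of the fibre `{Ū = V₁}` is irregular, the right-hand integrand vanishes identically on the fibre, and its transport vanishes for
a.e. such `V₁` (the fibre lemma: two integrand families agreeing on the graph `V₁ = Ū` have a.e. equal transports — here the family cut off to the rough `V₁` against
ZERO).  Hence (§2) **`TLaw₁₃ θ p 0 ⇒ slotT_1(s′₀)(V₁) = 0 for a.e. `V₁` with `¬PlaqSmall (2α₀) V₁`** — at EVERY witness `θ`, whatever its `Zt` and whatever the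
term values: a condition on def-T's objects ALONE (`slotsTOfRecord … 1 s′₀ = transportOfRecord[w(s′₀)(·,V₁)·ρ₀]`, `slotsTOfRecord_one_apply`).  THE KERNEL HALF
OF Q-W (pub-ymgap INBOX, dag-n11-d g4 LOCATED-N11-WEIGHTS; dag-lead ME #15): the rev-16 (S1ᵀ) slot is satisfiable at its first step at some witness ONLY IF def-T's
step weights `w(s′₀)(U,V₁)` ((3.2)·(3.3)·ζ-labels through def-R's backgrounds) give the all-large-field label NO mass over rough coarse fields — def-T's ONE LINE
to confirm or deny (heuristically they DO give it mass: over a rough `V₁` the gauge copies `bg(V₁)^g`, `g` trivial on the coarse sites, are (3.3)-far from the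
background on every cube; this file does not decide it — no fibre-positivity fact is in the tree).  At `θ.Zt = ZtOfRecord` the displayed measurability ∕ bound
are discharged (§3, via file 1); at K0a's witness of record the statement's hypotheses are `0 ≤ g₀`, `0 < K`, the `α₀` guards and `TLaw₁₃` only.

WHAT THIS FILE PROVES (0 `sorry`, 0 `def`, standard axioms; `N`-generic).  §1 `transportOfRecord_const_mul` (linearity face of def-T's transport),
`chiRegW_pairCfg_eq_zero_of_avg_rough` (contrapositive of n21-c's Prop. 2 at one step: a rough average has only `cR·ε₀`-irregular fine preimages, `cR·ε₀ ≤ α₀η₁²`,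
so p. 256's regularity factor vanishes there), **`transport_chiRegW_mul_ae_zero_on_rough`** (for EVERY family `Φ(V₁,U)`: the transport of `χreg_0(T)(U,V₁)·Φ(V₁,U)`
vanishes for a.e. rough `V₁`).  §2 **`slotsT_one_ae_zero_on_rough_of_tLaw₁₃`** (ANY `Zt`; measurability ∕ bound of the `Zt`-part displayed).  §3
**`slotsT_one_ae_zero_on_rough_of_tLaw₁₃_of_Zt_eq_ZtOfRecord`** (no displayed proviso but the junction, `M ≥ 1`, `0 < K`, the `α₀` guards),
`slotsT_one_ae_zero_on_rough_theta13LiveOfRecord` (K0a's witness of record: `0 ≤ g₀`, `0 < K`, guards, `TLaw₁₃`).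

HONEST FRAMING.  Count-neutral kernel bookkeeping on the tree's OWN objects; a NECESSARY CONDITION of the typed (S1ᵀ)₁₃ at its first step, NOT a proof that it
holds or fails at any witness; nothing of Bałaban's asserted or refuted (print's 𝐓 carries one weight family; the condition measures the TREE's split into def-T's
`w` and 12a's `Zt`·`χreg`); N11 ∕ K1‴ NOT discharged ∕ refuted; counts unmoved (typed 28∕28 · discharged 5∕28).  One finite four-torus programme at fixed
`ε = L^{−K}`; NOT ℝ⁴, NOT OS, NOT a mass gap, NOT Clay.  Sources: [III] Theorem p.245, (2.10) p.256, (2.21)–(2.23) p.258, (3.1)–(3.3) pp.264–265, (3.25)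
p.270; [B7] Prop. 2 (53) p.26, (10) p.19.
-/

noncomputable section

open MeasureTheory
open scoped BigOperators Matrix.Norms.L2Operator

namespace Summit.QuantumFields.YangMills.Theorems.BalabanUVNodesN11NoExpansionRoughFibre

open Literature.MathematicalPhysics.QuantumFieldTheory.Balaban1983to89 T4Continuum Node00 Node00.Tk DagBinding
open Literature.MathematicalPhysics.QuantumFieldTheory.Balaban1983to89.T4AveragingDisintegration (transportK kernelTransport)
open Literature.MathematicalPhysics.QuantumFieldTheory.Balaban1983to89.ExpMeanLog (deltaSU)
open Summit.QuantumFields.YangMills.Theorems.N21AveragedDatumRegularity (plaqSmall_iter_avOfRecord_level)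
open Summit.QuantumFields.YangMills.Theorems.BalabanUVNodesN11NoExpansionTermFree
  (tLaw₁₃_zero_termFree_of_Zt_eq_ZtOfRecord one_le_M_theta13LiveOfFamily)
open Summit.QuantumFields.YangMills.Theorems.BalabanUVNodesN11NoExpansionTermFreeAnyWeights (tLaw₁₃_zero_termFree)

variable {F : T4Family} {N : ℕ} [NeZero N]

/-! ## §1. Rough coarse fields have only irregular fine preimages; the transport of a `χreg`-cut integrand vanishes a.e. over them -/

section Rough

variable (θ : Stage13Params F N) (p : B12.RunParams)

/-- Linearity face of def-T's transport of record: a constant factor pulls out. [cite: Balaban1985Averaging, (10) p.19 (bookkeeping)] -/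
theorem transportOfRecord_const_mul (K k : ℕ) (c : ℝ) (ρ : Density (F.P K) k (SU N)) (V : GaugeField (F.P K) (k + 1) (SU N)) :
    transportOfRecord F N K k (fun U => c * ρ U) V = c * transportOfRecord F N K k ρ V := by
  show kernelTransport _ _ _ (fun U => c * ρ U) V = c * kernelTransport _ _ _ ρ V
  simp only [kernelTransport, integral_const_mul]
  ring

/-- **A ROUGH AVERAGE HAS ONLY `cR·ε₀`-IRREGULAR FINE PREIMAGES** (contrapositive of seat dag-n21-c's PROVED [B7] Prop. 2 at one step of the averaging of record,
`plaqSmall_iter_avOfRecord_level` with `k = j = 1`): under `cR·ε₀(g₀) ≤ α₀η₁²` and the displayed guards on `α₀`, if `Ū` is not `2α₀(Lη₁)²`-plaquette-small then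
`U` is not `cR·ε₀`-regular — p. 256's regularity factor `χreg_0(T)` VANISHES at `(U, Ū)`. [cite: Balaban1985Averaging, Prop. 2 (53) p.26; Balaban1988Convergent, (2.10) p.256] -/
theorem chiRegW_pairCfg_eq_zero_of_avg_rough {α₀ : ℝ} (hα : 0 < α₀)
    (hα3 : (143 * (((((F.P p.K).d + 4 : ℕ) : ℝ)) ^ 2 / 4) ^ 2) * α₀ ≤ 1 / 3)
    (hα2 : 2 * α₀ ≤ 2 * deltaSU (Fin N) / ((((F.P p.K).d + 4) * (F.P p.K).L : ℕ) : ℝ) ^ 2)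
    (hαε : θ.s2.cR * epsOfRecord θ.ν (gOfRecord₁₃ F N θ p) 0 ≤ α₀ * (F.P p.K).eta 1 ^ 2)
    (U : GaugeField (F.P p.K) 0 (SU N))
    (hV : ¬ PlaqSmall (2 * α₀ * (((F.P p.K).L : ℝ) ^ 1 * (F.P p.K).eta 1) ^ 2) ((avOfRecord F N p.K 0).avg U)) :
    chiRegW F N (FluctV N) θ.ν θ.s2.cR p (gOfRecord₁₃ F N θ p) 0 Set.univ (pairCfg (V := FluctV N) ((avOfRecord F N p.K 0).avg U) U) = 0 := by
  by_contra h
  have hreg : PlaqSmall (α₀ * (F.P p.K).eta 1 ^ 2) U := plaqSmall_of_chiRegW_zero_univ_ne_zero hαε h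
  have havg := plaqSmall_iter_avOfRecord_level (F := F) (N := N) p.K 1 hα hα3 hα2 hreg (le_refl 1)
  exact hV havg

/-- **THE TRANSPORT OF A `χreg`-CUT INTEGRAND VANISHES FOR a.e. ROUGH COARSE FIELD** (`0 < K`): for EVERY family `Φ(V₁, U)`,
`T[U ↦ χreg_0(T)(U,V₁)·Φ(V₁,U)](V₁) = 0` for `dV₁`-a.e. `V₁` with `¬PlaqSmall (2α₀(Lη₁)²) V₁` — the cut-off family and the zero family agree on the graph `V₁ = Ū`
(g3's `transportK_congr_ae_of_fibre`: no integrability, no fibre-positivity needed). [cite: Balaban1985Averaging, (10) p.19, Prop. 2 (53) p.26; Balaban1988Convergent, (2.10) p.256, (3.1) p.264] -/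
theorem transport_chiRegW_mul_ae_zero_on_rough (hK : 0 < p.K) {α₀ : ℝ} (hα : 0 < α₀)
    (hα3 : (143 * (((((F.P p.K).d + 4 : ℕ) : ℝ)) ^ 2 / 4) ^ 2) * α₀ ≤ 1 / 3)
    (hα2 : 2 * α₀ ≤ 2 * deltaSU (Fin N) / ((((F.P p.K).d + 4) * (F.P p.K).L : ℕ) : ℝ) ^ 2)
    (hαε : θ.s2.cR * epsOfRecord θ.ν (gOfRecord₁₃ F N θ p) 0 ≤ α₀ * (F.P p.K).eta 1 ^ 2)
    (Φ : GaugeField (F.P p.K) 1 (SU N) → GaugeField (F.P p.K) 0 (SU N) → ℝ) :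
    ∀ᵐ V1 ∂fieldMeasure (F.P p.K) 1 (SU N), ¬ PlaqSmall (2 * α₀ * (((F.P p.K).L : ℝ) ^ 1 * (F.P p.K).eta 1) ^ 2) V1 →
      transportOfRecord F N p.K 0 (fun U =>
        chiRegW F N (FluctV N) θ.ν θ.s2.cR p (gOfRecord₁₃ F N θ p) 0 Set.univ (pairCfg (V := FluctV N) V1 U) * Φ V1 U) V1 = 0 := by
  classical
  -- the family cut off to the rough coarse fields agrees with the zero family on the graph `V₁ = Ū`
  have h := transportK_congr_ae_of_fibre (avOfRecord_measurable F N p.K 0) (avOfRecord_haarAC F N p.K 0 hK)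
    (f := fun (V1 : GaugeField (F.P p.K) 1 (SU N)) (U : GaugeField (F.P p.K) 0 (SU N)) =>
      (if PlaqSmall (2 * α₀ * (((F.P p.K).L : ℝ) ^ 1 * (F.P p.K).eta 1) ^ 2) V1 then (0 : ℝ) else 1) *
        (chiRegW F N (FluctV N) θ.ν θ.s2.cR p (gOfRecord₁₃ F N θ p) 0 Set.univ (pairCfg (V := FluctV N) V1 U) * Φ V1 U))
    (g := fun _ _ => (0 : ℝ)) (fun U => by
      by_cases hs : PlaqSmall (2 * α₀ * (((F.P p.K).L : ℝ) ^ 1 * (F.P p.K).eta 1) ^ 2) ((avOfRecord F N p.K 0).avg U)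
      · simp only [hs, if_true, zero_mul]
      · rw [chiRegW_pairCfg_eq_zero_of_avg_rough θ p hα hα3 hα2 hαε U hs, zero_mul, mul_zero])
  filter_upwards [h] with V1 hV1 hrough
  have h0 : transportK (avOfRecord F N p.K 0).avg (fun _ => (0 : ℝ)) V1 = 0 := by
    show kernelTransport _ _ _ (fun _ => (0 : ℝ)) V1 = 0
    simp only [kernelTransport, integral_zero, mul_zero]
  have h1 : transportK (avOfRecord F N p.K 0).avg
      (fun U => (if PlaqSmall (2 * α₀ * (((F.P p.K).L : ℝ) ^ 1 * (F.P p.K).eta 1) ^ 2) V1 then (0 : ℝ) else 1) *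
        (chiRegW F N (FluctV N) θ.ν θ.s2.cR p (gOfRecord₁₃ F N θ p) 0 Set.univ (pairCfg (V := FluctV N) V1 U) * Φ V1 U)) V1 =
      transportOfRecord F N p.K 0 (fun U =>
        chiRegW F N (FluctV N) θ.ν θ.s2.cR p (gOfRecord₁₃ F N θ p) 0 Set.univ (pairCfg (V := FluctV N) V1 U) * Φ V1 U) V1 := by
    simp only [hrough, if_false, one_mul]
    rfl
  rw [← h1, hV1, h0]

end Rough

/-! ## §2. AT EVERY WITNESS: `TLaw₁₃ θ p 0` ⇒ the all-large-field pre-𝐑 slot vanishes a.e. on the rough coarse fields -/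

section AnyWitness

variable (θ : Stage13Params F N) (p : B12.RunParams)

/-- **`TLaw₁₃ θ p 0` FORCES def-T's ALL-LARGE-FIELD PRE-𝐑 SLOT TO VANISH ON THE ROUGH COARSE FIELDS — AT EVERY WITNESS** (any `θ.Zt`; junction, `M ≥ 1`, `0 < K`,
the `α₀` guards of [B7] Prop. 2 and `cR·ε₀ ≤ α₀η₁²`; the joint measurability ∕ bound of the `Zt`-part of the term-free integrand displayed, as in
`…TermFreeAnyWeights.tLaw₁₃_zero_termFree`): for the all-large-field new sequence `s′₀` (`Ω₁(s′₀) = ∅`),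
`slotsTOfRecord … 1 s′₀ V₁ = ∫dU δ(ŪV₁⁻¹) w(s′₀)(U,V₁)·ρ₀(U) = 0` for `dV₁`-a.e. `V₁` with `¬PlaqSmall (2α₀(Lη₁)²) V₁`.  A condition on def-T's step weights ALONE —
no 𝐄-term, no `Zt` can influence it. [cite: Balaban1988Convergent, Theorem p.245, (3.1)–(3.3) pp.264–265, (3.25) p.270, (2.10) p.256; Balaban1985Averaging, Prop. 2 (53) p.26] -/
theorem slotsT_one_ae_zero_on_rough_of_tLaw₁₃ (hc : θ.s2.cR * epsOfRecord θ.ν (gOfRecord₁₃ F N θ p) 0 ≤ θ.ν.εreg * (F.P p.K).eta 0 ^ 2)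
    (hM : 1 ≤ θ.τ9.M) (hK : 0 < p.K) (s : SeqOfRecord F θ.ν θ.τ9.M (gOfRecord₁₃ F N θ p) p.K 1) (hΩ : s.Ω 1 = ∅)
    (hT : TLaw₁₃ F N θ p 0) {α₀ : ℝ} (hα : 0 < α₀)
    (hα3 : (143 * (((((F.P p.K).d + 4 : ℕ) : ℝ)) ^ 2 / 4) ^ 2) * α₀ ≤ 1 / 3)
    (hα2 : 2 * α₀ ≤ 2 * deltaSU (Fin N) / ((((F.P p.K).d + 4) * (F.P p.K).L : ℕ) : ℝ) ^ 2)
    (hαε : θ.s2.cR * epsOfRecord θ.ν (gOfRecord₁₃ F N θ p) 0 ≤ α₀ * (F.P p.K).eta 1 ^ 2)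
    {C : ℝ}
    (hm : Measurable (Function.uncurry fun (V1 : GaugeField (F.P p.K) 1 (SU N)) (Uf : GaugeField (F.P p.K) 0 (SU N)) =>
      (θ.Zt p.K).ζ0 0 Set.univ (pairCfg V1 Uf) *
          chiRegW F N (FluctV N) θ.ν θ.s2.cR p (gOfRecord₁₃ F N θ p) 0 Set.univ (pairCfg (V := FluctV N) V1 Uf) *
        (Real.exp (-(1 / 2 : ℝ) * (θ.Zt p.K).quad 0 ∅ (pairCfg V1 Uf)) * rhoZeroOfRecord F N p.K p.g0 (EOfRecord₁₃ F N θ p) Uf)))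
    (hC : ∀ (V1 : GaugeField (F.P p.K) 1 (SU N)) (Uf : GaugeField (F.P p.K) 0 (SU N)),
      |(θ.Zt p.K).ζ0 0 Set.univ (pairCfg V1 Uf) *
          chiRegW F N (FluctV N) θ.ν θ.s2.cR p (gOfRecord₁₃ F N θ p) 0 Set.univ (pairCfg (V := FluctV N) V1 Uf) *
        (Real.exp (-(1 / 2 : ℝ) * (θ.Zt p.K).quad 0 ∅ (pairCfg V1 Uf)) * rhoZeroOfRecord F N p.K p.g0 (EOfRecord₁₃ F N θ p) Uf)| ≤ C) :
    ∀ᵐ V1 ∂fieldMeasure (F.P p.K) 1 (SU N), ¬ PlaqSmall (2 * α₀ * (((F.P p.K).L : ℝ) ^ 1 * (F.P p.K).eta 1) ^ 2) V1 →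
      slotsTOfRecord F N θ.ν θ.τ9 (EOfRecord₁₃ F N θ) (wOfRecord₉ F N θ.toStage9Params) θ.ppSel p (gOfRecord₁₃ F N θ p) 1 s V1 = 0 := by
  obtain ⟨Ek, hcl⟩ := tLaw₁₃_zero_termFree θ p hc hM hK s hΩ hT hm hC
  rcases hcl with h0 | hid
  · exact Filter.Eventually.of_forall fun V1 _ => by rw [h0]; rfl
  · have hR := transport_chiRegW_mul_ae_zero_on_rough θ p hK hα hα3 hα2 hαε
      (fun V1 Uf => (θ.Zt p.K).ζ0 0 Set.univ (pairCfg V1 Uf) *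
        (Real.exp (-(1 / 2 : ℝ) * (θ.Zt p.K).quad 0 ∅ (pairCfg V1 Uf)) *
          (Real.exp (EOfRecord₁₃ F N θ p - Ek) * rhoZeroOfRecord F N p.K p.g0 (EOfRecord₁₃ F N θ p) Uf)))
    filter_upwards [hid, hR] with V1 hV1 hR1 hrough
    rw [slotsTOfRecord_one_apply, hV1]
    rw [← hR1 hrough]
    congr 1
    funext Uf
    ring

end AnyWitness

/-! ## §3. AT A WITNESS CARRYING K0b's `ZtOfRecord` (provisos discharged) and at K0a's witness of record -/

section AtRecordWeights

variable (θ : Stage13Params F N) (p : B12.RunParams)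

/-- **THE SAME AT A `θ` WITH `θ.Zt = ZtOfRecord`, NO displayed proviso but the junction, `M ≥ 1`, `0 < K` and the `α₀` guards** (file 1's discharged
measurability ∕ bound). [cite: Balaban1988Convergent, Theorem p.245, (3.25) p.270, (2.10) p.256; Balaban1985Averaging, Prop. 2 (53) p.26] -/
theorem slotsT_one_ae_zero_on_rough_of_tLaw₁₃_of_Zt_eq_ZtOfRecord (hZt : θ.Zt = ZtOfRecord F N)
    (hc : θ.s2.cR * epsOfRecord θ.ν (gOfRecord₁₃ F N θ p) 0 ≤ θ.ν.εreg * (F.P p.K).eta 0 ^ 2)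
    (hM : 1 ≤ θ.τ9.M) (hK : 0 < p.K) (s : SeqOfRecord F θ.ν θ.τ9.M (gOfRecord₁₃ F N θ p) p.K 1) (hΩ : s.Ω 1 = ∅)
    (hT : TLaw₁₃ F N θ p 0) {α₀ : ℝ} (hα : 0 < α₀)
    (hα3 : (143 * (((((F.P p.K).d + 4 : ℕ) : ℝ)) ^ 2 / 4) ^ 2) * α₀ ≤ 1 / 3)
    (hα2 : 2 * α₀ ≤ 2 * deltaSU (Fin N) / ((((F.P p.K).d + 4) * (F.P p.K).L : ℕ) : ℝ) ^ 2)
    (hαε : θ.s2.cR * epsOfRecord θ.ν (gOfRecord₁₃ F N θ p) 0 ≤ α₀ * (F.P p.K).eta 1 ^ 2) :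
    ∀ᵐ V1 ∂fieldMeasure (F.P p.K) 1 (SU N), ¬ PlaqSmall (2 * α₀ * (((F.P p.K).L : ℝ) ^ 1 * (F.P p.K).eta 1) ^ 2) V1 →
      slotsTOfRecord F N θ.ν θ.τ9 (EOfRecord₁₃ F N θ) (wOfRecord₉ F N θ.toStage9Params) θ.ppSel p (gOfRecord₁₃ F N θ p) 1 s V1 = 0 := by
  obtain ⟨Ek, hcl⟩ := tLaw₁₃_zero_termFree_of_Zt_eq_ZtOfRecord θ p hZt hc hM hK s hΩ hT
  rcases hcl with h0 | hid
  · exact Filter.Eventually.of_forall fun V1 _ => by rw [h0]; rfl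
  · have hR := transport_chiRegW_mul_ae_zero_on_rough θ p hK hα hα3 hα2 hαε
      (fun V1 Uf => ((Nat.card (Set (Site (F.P p.K) 0)) : ℝ))⁻¹ *
        (Real.exp (EOfRecord₁₃ F N θ p - Ek) * rhoZeroOfRecord F N p.K p.g0 (EOfRecord₁₃ F N θ p) Uf))
    filter_upwards [hid, hR] with V1 hV1 hR1 hrough
    rw [slotsTOfRecord_one_apply, hV1]
    rw [← hR1 hrough]
    congr 1
    funext Uf
    ring

variable (F N)

/-- **AT K0a's WITNESS OF RECORD `theta13LiveOfRecord`** (`Zt := ZtOfRecord`, `cR = εreg = 1`, `τ9.M = 1`): on every run with `0 ≤ g₀`, `0 < K`, if K1‴'s N11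
conjunct is to survive its first step there (`TLaw₁₃ … 0`), def-T's all-large-field pre-𝐑 slot VANISHES for a.e. coarse field that is not `2α₀`-plaquette-small
(`ε₀(g₀) ≤ α₀η₁²`, [B7] guards on `α₀`). [cite: Balaban1988Convergent, Theorem p.245, (3.25) p.270, (2.10) p.256; Balaban1985Averaging, Prop. 2 (53) p.26] -/
theorem slotsT_one_ae_zero_on_rough_theta13LiveOfRecord (p : B12.RunParams) (hg : 0 ≤ p.g0) (hK : 0 < p.K)
    (s : SeqOfRecord F (theta13LiveOfRecord F N).ν (theta13LiveOfRecord F N).τ9.M (gOfRecord₁₃ F N (theta13LiveOfRecord F N) p) p.K 1)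
    (hΩ : s.Ω 1 = ∅) (hT : TLaw₁₃ F N (theta13LiveOfRecord F N) p 0) {α₀ : ℝ} (hα : 0 < α₀)
    (hα3 : (143 * (((((F.P p.K).d + 4 : ℕ) : ℝ)) ^ 2 / 4) ^ 2) * α₀ ≤ 1 / 3)
    (hα2 : 2 * α₀ ≤ 2 * deltaSU (Fin N) / ((((F.P p.K).d + 4) * (F.P p.K).L : ℕ) : ℝ) ^ 2)
    (hαε : (theta13LiveOfRecord F N).s2.cR * epsOfRecord (theta13LiveOfRecord F N).ν (gOfRecord₁₃ F N (theta13LiveOfRecord F N) p) 0 ≤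
      α₀ * (F.P p.K).eta 1 ^ 2) :
    ∀ᵐ V1 ∂fieldMeasure (F.P p.K) 1 (SU N), ¬ PlaqSmall (2 * α₀ * (((F.P p.K).L : ℝ) ^ 1 * (F.P p.K).eta 1) ^ 2) V1 →
      slotsTOfRecord F N (theta13LiveOfRecord F N).ν (theta13LiveOfRecord F N).τ9 (EOfRecord₁₃ F N (theta13LiveOfRecord F N))
        (wOfRecord₉ F N (theta13LiveOfRecord F N).toStage9Params) (theta13LiveOfRecord F N).ppSel p
        (gOfRecord₁₃ F N (theta13LiveOfRecord F N) p) 1 s V1 = 0 :=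
  slotsT_one_ae_zero_on_rough_of_tLaw₁₃_of_Zt_eq_ZtOfRecord _ p (Zt_theta13LiveOfFamily F N eps0OfRecord₁₃ _ _ (ZtOfRecord F N))
    (lettersJunction_theta13LiveOfRecord F N p hg) (one_le_M_theta13LiveOfFamily F N eps0OfRecord₁₃ _ _ (ZtOfRecord F N)) hK s hΩ hT hα hα3 hα2 hαε

end AtRecordWeights

end Summit.QuantumFields.YangMills.Theorems.BalabanUVNodesN11NoExpansionRoughFibre

end
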